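import Summits.QuantumFields.YangMills.Theorems.BalabanUVNodesN08HaarCompatibilityGuardMonotoneDefect

/-!
# BalabanUVNodes ∕ N08 — THE TRIVIALISED TANGENT OF THE PRINTED exp-mean-log FIBRE MAP PAIRS POSITIVELY WITH THE DIRECTION OF MOTION
# (item 3, part 30B: the pairing estimate behind the monotone height)

WIDTH SEAT `pub-ymgap-dag-n08-w3` g6, item-3 lineage, 2026-08-28.  DAG node N08 = [Balaban1985UV3] Thm 1 p. 257 (compact) + Thm 2 p. 272; the typed (0.4) averaging
and its guard = [Balaban1987RG1] (0.4) p. 253; key item K1⁷ `StabilityBAtRecordR13SepCoPH` (stmt-QuantumFields-20542, `aside`), `--supports … --as helper`.  COUNT-NEUTRAL.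

WHAT THIS FILE PROVES (theorems only, 0 def; over part 30A `…GuardMonotoneDefect` BY IMPORT):
  `exists_defect_linearMap` (the defect operator IS `ℝ`-linear) · ★ `norm_N_sub_sum_N_le`: **`‖N_Y X − Σᵢ cᵢ N_{Zᵢ} X‖ ≤ (λ′ + β)‖X‖`** (`λ′ = 1 − Σcᵢ`, any `β ≥ ψ(θ)`,
  `‖Zᵢ‖ ≤ θ ≤ 1`) — the fibre map is `(λ′ + β)`-Lipschitz along guarded geodesics · `sinc_mul_cos_bounds` (`(1 − θ²∕6)(1 − θ²∕2) ≤ sinc t·cos t ≤ 1` on `[0, θ]`) ·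
  ★★ `inner_trivialised_ge`: for the right-trivialised tangent `m = par_Y M + (sinc·cos)(‖Y‖)·perp_Y M + sinc²(‖Y‖)·(Y·perp_Y M)` (`M = P X`; part 30C shows
  `m = D exp(Y)(M)·e^{−Y}`):  **`⟪m, X⟫ ≥ (λ′a₀ − β((1−a₀)² + θ²)∕(4a₀))·‖X‖²`**, `a₀ = (1 − θ²∕6)(1 − θ²∕2)` — expansion
  `⟪m, X⟫ = λ′(‖par_Y X‖² + a‖perp_Y X‖²) + a⟪BX,X⟫ + (1−a)⟪BX, par_Y X⟫ − sinc²⟪BX, Y·perp_Y X⟫`, psd Cauchy–Schwarz (30A) on the two cross terms, completion of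
  the square.  At the typed guard (`θ = 17∕50`, `β = 1∕24`) the constant is `c₁ ≈ 0.924λ′ − 0.00137`, positive for `λ′ ≥ 1∕660`; part 30C needs `c₁ > θ(λ′ + β)²`,
  true for `λ′ ≥ 1∕400`.  (Seat numerics, evidence only: the pairing is `≈ λ′·a₀` in every test — the kernel bound is conservative.)

HONEST FRAMING.  [folklore] quaternion linear algebra ∕ calculus over pub-balaban's `T4QuatExpLog` ∕ `T4EMLFibreAC` and n08-w6's `ψ` facts BY IMPORT; nothing of
Bałaban's asserted; E6′ NOT decided; the k-uniform `hmass` NOT supplied; count-neutral; N08 NOT discharged; counts unmoved (typed 28∕28 · discharged 5∕27); one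
finite 𝕋⁴ programme at fixed ε — R4 closes the CONDITIONAL rung `BalabanLadder.UV` only; the Yang–Mills mass gap (Clay) is NOT proved by any of this; nothing
continuum ∕ OS.  0 `sorry`, 0 `def`, 0 `instance`, 0 `notation`, standard axioms.
-/

noncomputable section

open NormedSpace Set Metric Function Filter
open scoped RealInnerProductSpace Topology Quaternion

namespace Summit.QuantumFields.YangMills.BalabanUVNodes.N08HaarCompatibilityGuardMonotonePairing

open Literature.MathematicalPhysics.QuantumFieldTheory.Balaban1983to89
open Literature.MathematicalPhysics.QuantumFieldTheory.Balaban1983to89.T4QuatExpLog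
open Literature.MathematicalPhysics.QuantumFieldTheory.Balaban1983to89.T4EMLFibreAC
open Summit.QuantumFields.YangMills.BalabanUVNodes.N08HaarCompatibilityGuardGeodesics
open Summit.QuantumFields.YangMills.BalabanUVNodes.N08HaarCompatibilityGuardJacobianContractionFrame (ψ_nonneg_of_abs_lt_pi ψ_le_ψ_of_abs_le)

open Summit.QuantumFields.YangMills.BalabanUVNodes.N08HaarCompatibilityGuardMonotoneDefect

/-! ## §4 The trivialised tangent pairs positively with the direction of motion -/

section Pairing

variable {ι : Type*} [Fintype ι]

/-- The defect operator IS an `ℝ`-linear map (`perp_w` is linear). [folklore] -/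
theorem exists_defect_linearMap (Z : ι → ℍ) (c : ι → ℝ) (Y : ℍ) :
    ∃ B : ℍ →ₗ[ℝ] ℍ, ∀ x, B x = ∑ i, (c i * ψ ‖Z i‖) • perp (Z i) x - ψ ‖Y‖ • perp Y x :=
  ⟨{ toFun := fun x => ∑ i, (c i * ψ ‖Z i‖) • perp (Z i) x - ψ ‖Y‖ • perp Y x
     map_add' := fun x y => by
       simp only [perp_add, smul_add, Finset.sum_add_distrib]
       abel
     map_smul' := fun t x => by
       simp only [RingHom.id_apply, perp_smul, smul_sub, Finset.smul_sum, smul_smul]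
       congr 1
       · exact Finset.sum_congr rfl fun i _ => by rw [mul_comm (c i * ψ ‖Z i‖) t]
       · rw [mul_comm] }, fun _ => rfl⟩

/-- ★ **THE TANGENT IS SHORT**: `‖N_Y X − Σᵢ cᵢ N_{Zᵢ} X‖ ≤ (λ′ + β)‖X‖` (`λ′ = 1 − Σcᵢ`, `β ≥ ψ(θ)`; `P = λ′·id + B` with `‖B‖ ≤ β` from the psd
Cauchy–Schwarz) — hence the fibre map is `(λ′ + β)`-Lipschitz along guarded geodesics (part 30B). [folklore] -/
theorem norm_N_sub_sum_N_le {Z : ι → ℍ} {c : ι → ℝ} (hZ : ∀ i, (Z i).re = 0) (hc : ∀ i, 0 ≤ c i) (hs : ∑ i, c i ≤ 1)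
    {θ : ℝ} (hθ0 : 0 < θ) (hθ1 : θ ≤ 1) (hZθ : ∀ i, ‖Z i‖ ≤ θ) {β : ℝ} (hβ : ψ θ ≤ β) {X : ℍ} (hX : X.re = 0) :
    ‖N (∑ i, c i • Z i) X - ∑ i, c i • N (Z i) X‖ ≤ (1 - ∑ i, c i + β) * ‖X‖ := by
  set Y : ℍ := ∑ i, c i • Z i with hY
  have hθπ : θ < Real.pi := by linarith [Real.pi_gt_three]
  have hYre : Y.re = 0 :=
    Finset.sum_induction _ (fun q : ℍ => q.re = 0) (fun p q hp hq => by rw [Quaternion.re_add, hp, hq, add_zero])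
      Quaternion.re_zero (fun i _ => by rw [Quaternion.re_smul, hZ i, smul_zero])
  have hYθ : ‖Y‖ ≤ θ := by
    calc ‖∑ i, c i • Z i‖ ≤ ∑ i, ‖c i • Z i‖ := norm_sum_le _ _
      _ ≤ ∑ i, c i * θ := Finset.sum_le_sum fun i _ => by
          rw [norm_smul, Real.norm_of_nonneg (hc i)]; exact mul_le_mul_of_nonneg_left (hZθ i) (hc i)
      _ = (∑ i, c i) * θ := by rw [Finset.sum_mul]
      _ ≤ 1 * θ := mul_le_mul_of_nonneg_right hs hθ0.le
      _ = θ := one_mul θ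
  have hYπ : ‖Y‖ < Real.pi := hYθ.trans_lt hθπ
  have hZball : ∀ i, Z i ∈ imBall := fun i => ⟨hZ i, (hZθ i).trans_lt hθπ⟩
  have hψθ : 0 ≤ ψ θ := ψ_nonneg_of_abs_lt_pi (by rwa [abs_of_nonneg hθ0.le])
  have hβ0 : 0 ≤ β := hψθ.trans hβ
  obtain ⟨B, hBapply⟩ := exists_defect_linearMap Z c Y
  have hsym : ∀ x y : ℍ, x.re = 0 → y.re = 0 → ⟪B x, y⟫ = ⟪x, B y⟫ := fun x y _ _ => by
    rw [hBapply, hBapply]; exact defect_inner_comm Z c Y x y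
  have hpsd : ∀ x : ℍ, x.re = 0 → 0 ≤ ⟪B x, x⟫ := fun x _ => by
    rw [hBapply, hY]; exact defect_inner_self_nonneg hZball hc hs x
  have hβ' : ∀ x : ℍ, x.re = 0 → ⟪B x, x⟫ ≤ β * ‖x‖ ^ 2 := fun x _ => by
    rw [hBapply]
    exact (defect_inner_self_le hc hs hθ0.le hθπ hZθ hYπ x).trans (mul_le_mul_of_nonneg_right hβ (sq_nonneg _))
  have him : ∀ x : ℍ, x.re = 0 → (B x).re = 0 := fun x hx => by rw [hBapply]; exact defect_re hZ c hYre hx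
  have hPX : N Y X - ∑ i, c i • N (Z i) X = (1 - ∑ i, c i) • X + B X := by rw [hBapply, hY]; exact N_sub_sum_N_eq hZ c X
  rw [hPX]
  calc ‖(1 - ∑ i, c i) • X + B X‖ ≤ ‖(1 - ∑ i, c i) • X‖ + ‖B X‖ := norm_add_le _ _
    _ ≤ (1 - ∑ i, c i) * ‖X‖ + β * ‖X‖ := by
        rw [norm_smul, Real.norm_of_nonneg (by linarith)]
        exact add_le_add le_rfl (psd_norm_le B hsym hpsd hβ0 hβ' him hX)
    _ = (1 - ∑ i, c i + β) * ‖X‖ := by ring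

/-- `sinc t · cos t` on `[0, θ]`, `θ ≤ 1`: `(1 − θ²∕6)(1 − θ²∕2) ≤ sinc t · cos t ≤ 1` and `0 ≤ sinc t ≤ 1`. [folklore] -/
theorem sinc_mul_cos_bounds {t θ : ℝ} (ht0 : 0 ≤ t) (htθ : t ≤ θ) (hθ1 : θ ≤ 1) :
    (1 - θ ^ 2 / 6) * (1 - θ ^ 2 / 2) ≤ Real.sinc t * Real.cos t ∧ Real.sinc t * Real.cos t ≤ 1 ∧
      0 ≤ Real.sinc t ∧ Real.sinc t ≤ 1 := by
  have hsinc_ge : 1 - t ^ 2 / 6 ≤ Real.sinc t := by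
    rcases eq_or_lt_of_le ht0 with h0 | h0
    · rw [← h0, Real.sinc_zero]; norm_num
    · rw [Real.sinc_of_ne_zero h0.ne', le_div_iff₀ h0]
      have := Real.sin_ge_sub_cube h0.le
      nlinarith
  have hsinc_le : Real.sinc t ≤ 1 := Real.sinc_le_one t
  have hcos_ge : 1 - t ^ 2 / 2 ≤ Real.cos t := Real.one_sub_sq_div_two_le_cos
  have hcos_le : Real.cos t ≤ 1 := Real.cos_le_one t
  have ht1 : t ≤ 1 := htθ.trans hθ1
  have h6 : (1 - θ ^ 2 / 6) ≤ 1 - t ^ 2 / 6 := by nlinarith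
  have h2 : (1 - θ ^ 2 / 2) ≤ 1 - t ^ 2 / 2 := by nlinarith
  have h6n : 0 ≤ 1 - θ ^ 2 / 6 := by nlinarith
  have h2n : 0 ≤ 1 - t ^ 2 / 2 := by nlinarith
  have hsinc0 : 0 ≤ Real.sinc t := le_trans (by nlinarith) hsinc_ge
  have hcos0 : 0 ≤ Real.cos t := le_trans h2n hcos_ge
  refine ⟨?_, ?_, hsinc0, hsinc_le⟩
  · calc (1 - θ ^ 2 / 6) * (1 - θ ^ 2 / 2) ≤ (1 - t ^ 2 / 6) * (1 - t ^ 2 / 2) :=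
          mul_le_mul h6 h2 (by nlinarith) (by nlinarith)
      _ ≤ Real.sinc t * Real.cos t := mul_le_mul hsinc_ge hcos_ge h2n hsinc0
  · calc Real.sinc t * Real.cos t ≤ 1 * 1 := mul_le_mul hsinc_le hcos_le hcos0 zero_le_one
      _ = 1 := one_mul _

/-- ★★ **THE TRIVIALISED TANGENT PAIRS POSITIVELY WITH THE DIRECTION OF MOTION.**  Imaginary `Zᵢ` with `‖Zᵢ‖ ≤ θ`, `0 < θ ≤ 1`, weights `cᵢ ≥ 0`,
`Σcᵢ ≤ 1`, `Y = Σᵢ cᵢ Zᵢ`, imaginary `X`, `M = N_Y X − Σᵢ cᵢ N_{Zᵢ} X` and any `β ≥ ψ(θ)`; with `a₀ = (1 − θ²∕6)(1 − θ²∕2)` and the right-trivialised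
tangent `m = par_Y M + (sinc·cos)(‖Y‖)·perp_Y M + sinc²(‖Y‖)·(Y·perp_Y M)`:
**`(λ′a₀ − β((1 − a₀)² + θ²)∕(4a₀))·‖X‖² ≤ ⟪m, X⟫`**, `λ′ = 1 − Σcᵢ`.  Mechanism: `M = λ′X + BX` (§1), `⟪m, X⟫ = λ′(‖par X‖² + a‖perp X‖²) + a⟪BX,X⟫ +
(1−a)⟪BX, par_Y X⟫ − sinc²⟪BX, Y·perp_Y X⟫`, psd Cauchy–Schwarz (§2∕§3) on the two cross terms, completion of the square. [folklore] -/
theorem inner_trivialised_ge {Z : ι → ℍ} {c : ι → ℝ} (hZ : ∀ i, (Z i).re = 0) (hc : ∀ i, 0 ≤ c i) (hs : ∑ i, c i ≤ 1)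
    {θ : ℝ} (hθ0 : 0 < θ) (hθ1 : θ ≤ 1) (hZθ : ∀ i, ‖Z i‖ ≤ θ) {β : ℝ} (hβ : ψ θ ≤ β) {X : ℍ} (hX : X.re = 0)
    {Y M : ℍ} (hY : Y = ∑ i, c i • Z i) (hM : M = N Y X - ∑ i, c i • N (Z i) X) :
    ((1 - ∑ i, c i) * ((1 - θ ^ 2 / 6) * (1 - θ ^ 2 / 2)) -
        β * ((1 - (1 - θ ^ 2 / 6) * (1 - θ ^ 2 / 2)) ^ 2 + θ ^ 2) / (4 * ((1 - θ ^ 2 / 6) * (1 - θ ^ 2 / 2)))) * ‖X‖ ^ 2 ≤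
      ⟪par Y M + (Real.sinc ‖Y‖ * Real.cos ‖Y‖) • perp Y M + Real.sinc ‖Y‖ ^ 2 • (Y * perp Y M), X⟫ := by
  -- constants and the geometry of `Y`
  set s : ℝ := ∑ i, c i with hs_def
  set a₀ : ℝ := (1 - θ ^ 2 / 6) * (1 - θ ^ 2 / 2) with ha₀_def
  have hθπ : θ < Real.pi := by linarith [Real.pi_gt_three]
  have hYre : Y.re = 0 := by
    rw [hY]
    exact Finset.sum_induction _ (fun q : ℍ => q.re = 0) (fun p q hp hq => by rw [Quaternion.re_add, hp, hq, add_zero])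
      Quaternion.re_zero (fun i _ => by rw [Quaternion.re_smul, hZ i, smul_zero])
  have hYθ : ‖Y‖ ≤ θ := by
    rw [hY]
    calc ‖∑ i, c i • Z i‖ ≤ ∑ i, ‖c i • Z i‖ := norm_sum_le _ _
      _ ≤ ∑ i, c i * θ := Finset.sum_le_sum fun i _ => by
          rw [norm_smul, Real.norm_of_nonneg (hc i)]; exact mul_le_mul_of_nonneg_left (hZθ i) (hc i)
      _ = s * θ := by rw [Finset.sum_mul]
      _ ≤ 1 * θ := mul_le_mul_of_nonneg_right hs hθ0.le
      _ = θ := one_mul θ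
  have hYπ : ‖Y‖ < Real.pi := hYθ.trans_lt hθπ
  have hZball : ∀ i, Z i ∈ imBall := fun i => ⟨hZ i, (hZθ i).trans_lt hθπ⟩
  have hl0 : 0 ≤ 1 - s := by linarith
  have hψθ : 0 ≤ ψ θ := ψ_nonneg_of_abs_lt_pi (by rwa [abs_of_nonneg hθ0.le])
  have hβ0 : 0 ≤ β := hψθ.trans hβ
  -- the defect operator as a linear map
  obtain ⟨B, hBapply⟩ := exists_defect_linearMap Z c Y
  have hsym : ∀ x y : ℍ, x.re = 0 → y.re = 0 → ⟪B x, y⟫ = ⟪x, B y⟫ := fun x y _ _ => by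
    rw [hBapply, hBapply]; exact defect_inner_comm Z c Y x y
  have hpsd : ∀ x : ℍ, x.re = 0 → 0 ≤ ⟪B x, x⟫ := fun x _ => by
    rw [hBapply, hY]; exact defect_inner_self_nonneg hZball hc hs x
  have hβ' : ∀ x : ℍ, x.re = 0 → ⟪B x, x⟫ ≤ β * ‖x‖ ^ 2 := fun x _ => by
    rw [hBapply]
    exact (defect_inner_self_le hc hs hθ0.le hθπ hZθ hYπ x).trans (mul_le_mul_of_nonneg_right hβ (sq_nonneg _))
  have him : ∀ x : ℍ, x.re = 0 → (B x).re = 0 := fun x hx => by rw [hBapply]; exact defect_re hZ c hYre hx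
  -- `M = λ′X + BX`
  have hMX : M = (1 - s) • X + B X := by rw [hM, hBapply, hY]; exact N_sub_sum_N_eq hZ c X
  have hMre : M.re = 0 := by rw [hMX, Quaternion.re_add, Quaternion.re_smul, hX, smul_zero, zero_add, him X hX]
  -- the three pieces of `⟪m, X⟫`
  set p := par Y X with hp_def
  set q := perp Y X with hq_def
  set v := Y * perp Y X with hv_def
  have hp_re : p.re = 0 := par_re hYre X
  have hq_re : q.re = 0 := perp_re hYre hX
  have hv_re : v.re = 0 := by
    have h := inner_perp Y X
    rw [Quaternion.inner_def] at h
    have hsq : star q = -q := Quaternion.star_eq_neg.2 hq_re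
    rw [← hq_def, hsq, mul_neg, Quaternion.re_neg, neg_eq_zero] at h
    rw [hv_def, ← hq_def, h]
  -- ⟪par_Y M, X⟫ and ⟪perp_Y M, X⟫
  have h_par : ⟪par Y M, X⟫ = (1 - s) * ‖p‖ ^ 2 + ⟪B X, p⟫ := by
    rw [inner_par_comm, ← hp_def, hMX, inner_add_left, real_inner_smul_left, inner_self_par]
  have h_perp : ⟪perp Y M, X⟫ = (1 - s) * ‖q‖ ^ 2 + (⟪B X, X⟫ - ⟪B X, p⟫) := by
    rw [inner_perp_comm, ← hq_def, hMX, inner_add_left, real_inner_smul_left, inner_self_perp]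
    congr 1
    rw [hq_def, perp, inner_sub_right]
  -- ⟪Y·perp_Y M, X⟫ = −⟪BX, v⟫
  have h_skew : ⟪Y * perp Y M, X⟫ = -⟪B X, v⟫ := by
    have h1 : Y * perp Y M = Y * M + ((⟪Y, M⟫ : ℝ) : ℍ) := mul_perp hYre M
    have h2 : Y * X = v - ((⟪Y, X⟫ : ℝ) : ℍ) := by rw [hv_def, mul_perp hYre X, add_sub_cancel_right]
    have hstar : star Y = -Y := Quaternion.star_eq_neg.2 hYre
    have e1 : ⟪Y * perp Y M, X⟫ = ⟪Y * M, X⟫ := by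
      rw [h1, inner_add_left, real_inner_comm X ((⟪Y, M⟫ : ℝ) : ℍ), inner_coe_right_of_re hX, add_zero]
    have e2 : ⟪Y * M, X⟫ = -⟪M, v⟫ := by
      rw [inner_mul_left_eq, hstar, neg_mul, inner_neg_right, h2, inner_sub_right, inner_coe_right_of_re hMre, sub_zero]
    have e3 : ⟪M, v⟫ = ⟪B X, v⟫ := by
      rw [hMX, inner_add_left, real_inner_smul_left, hv_def, real_inner_comm (Y * perp Y X) X, inner_mul_perp hYre hX,
        mul_zero, zero_add]
    rw [e1, e2, e3]
  -- trigonometric coefficients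
  obtain ⟨ha0, ha1, hsinc0, hsinc1⟩ := sinc_mul_cos_bounds (norm_nonneg Y) hYθ hθ1
  rw [← ha₀_def] at ha0
  set a : ℝ := Real.sinc ‖Y‖ * Real.cos ‖Y‖ with ha_def
  set σ : ℝ := Real.sinc ‖Y‖ with hσ_def
  have hσ2 : σ ^ 2 ≤ 1 := by nlinarith only [hsinc0, hsinc1]
  have ha₀pos : 0 < a₀ := by
    have h1 : 0 < 1 - θ ^ 2 / 6 := by nlinarith
    have h2 : 0 < 1 - θ ^ 2 / 2 := by nlinarith
    exact mul_pos h1 h2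
  have ha₀1 : a₀ ≤ 1 := ha0.trans ha1
  have h4a : 0 < 4 * a₀ := by linarith only [ha₀pos]
  -- Cauchy–Schwarz on the cross terms
  set u : ℝ := Real.sqrt ⟪B X, X⟫ with hu_def
  have hu0 : 0 ≤ u := Real.sqrt_nonneg _
  have hu2 : u ^ 2 = ⟪B X, X⟫ := Real.sq_sqrt (hpsd X hX)
  have hBp : |⟪B X, p⟫| ≤ u * (Real.sqrt β * ‖p‖) := psd_abs_inner_le B hsym hpsd hβ' hX hp_re
  have hBv : |⟪B X, v⟫| ≤ u * (Real.sqrt β * ‖v‖) := psd_abs_inner_le B hsym hpsd hβ' hX hv_re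
  have hvn : ‖v‖ ≤ θ * ‖q‖ := by
    rw [hv_def, norm_mul, ← hq_def]; exact mul_le_mul_of_nonneg_right hYθ (norm_nonneg _)
  have hsβ : 0 ≤ Real.sqrt β := Real.sqrt_nonneg β
  have hsβ2 : Real.sqrt β ^ 2 = β := Real.sq_sqrt hβ0
  have hpq : ‖p‖ ^ 2 + ‖q‖ ^ 2 = ‖X‖ ^ 2 := norm_par_sq_add_norm_perp_sq Y X
  -- the expansion of ⟪m, X⟫
  have hexp : ⟪par Y M + a • perp Y M + σ ^ 2 • (Y * perp Y M), X⟫ =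
      (1 - s) * (‖p‖ ^ 2 + a * ‖q‖ ^ 2) + a * u ^ 2 + (1 - a) * ⟪B X, p⟫ - σ ^ 2 * ⟪B X, v⟫ := by
    rw [inner_add_left, inner_add_left, real_inner_smul_left, real_inner_smul_left, h_par, h_perp, h_skew, hu2]
    ring
  -- forget the definitions of the auxiliary quantities (only the recorded relations are used below)
  clear_value u σ a v q p
  -- the four lower bounds
  have hl1 : (1 - s) * a₀ * ‖X‖ ^ 2 ≤ (1 - s) * (‖p‖ ^ 2 + a * ‖q‖ ^ 2) := by
    have h : a₀ * ‖X‖ ^ 2 ≤ ‖p‖ ^ 2 + a * ‖q‖ ^ 2 := by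
      rw [← hpq]
      have f1 := mul_nonneg (sub_nonneg.2 ha₀1) (sq_nonneg ‖p‖)
      have f2 := mul_nonneg (sub_nonneg.2 ha0) (sq_nonneg ‖q‖)
      linarith only [f1, f2]
    have := mul_le_mul_of_nonneg_left h hl0
    linarith only [this]
  have hl2 : a₀ * u ^ 2 ≤ a * u ^ 2 := mul_le_mul_of_nonneg_right ha0 (sq_nonneg u)
  have hl3 : -((1 - a₀) * (u * (Real.sqrt β * ‖p‖))) ≤ (1 - a) * ⟪B X, p⟫ := by
    have ha1' : 0 ≤ 1 - a := by linarith only [ha1]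
    have h1 : (1 - a) * -|⟪B X, p⟫| ≤ (1 - a) * ⟪B X, p⟫ := mul_le_mul_of_nonneg_left (neg_abs_le _) ha1'
    have h2 : (1 - a) * |⟪B X, p⟫| ≤ (1 - a₀) * (u * (Real.sqrt β * ‖p‖)) :=
      mul_le_mul (by linarith only [ha0]) hBp (abs_nonneg _) (by linarith only [ha₀1])
    linarith only [h1, h2]
  have hl4 : σ ^ 2 * ⟪B X, v⟫ ≤ u * (Real.sqrt β * (θ * ‖q‖)) := by
    have h1 : σ ^ 2 * ⟪B X, v⟫ ≤ σ ^ 2 * |⟪B X, v⟫| := mul_le_mul_of_nonneg_left (le_abs_self _) (sq_nonneg _)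
    have h2 : |⟪B X, v⟫| ≤ u * (Real.sqrt β * (θ * ‖q‖)) :=
      hBv.trans (mul_le_mul_of_nonneg_left (mul_le_mul_of_nonneg_left hvn hsβ) hu0)
    have h3 : σ ^ 2 * |⟪B X, v⟫| ≤ 1 * (u * (Real.sqrt β * (θ * ‖q‖))) := mul_le_mul hσ2 h2 (abs_nonneg _) zero_le_one
    linarith only [h1, h3]
  set K : ℝ := (1 - a₀) * ‖p‖ + θ * ‖q‖ with hK_def
  have hmain : (1 - s) * a₀ * ‖X‖ ^ 2 + (a₀ * u ^ 2 - u * Real.sqrt β * K) ≤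
      ⟪par Y M + a • perp Y M + σ ^ 2 • (Y * perp Y M), X⟫ := by
    rw [hexp, hK_def]
    have hring : u * Real.sqrt β * ((1 - a₀) * ‖p‖ + θ * ‖q‖) =
        (1 - a₀) * (u * (Real.sqrt β * ‖p‖)) + u * (Real.sqrt β * (θ * ‖q‖)) := by ring
    rw [hring]
    linarith only [hl1, hl2, hl3, hl4]
  clear_value K
  -- completion of the square and Cauchy–Schwarz for the bracket
  have hsquare : -(β * K ^ 2 / (4 * a₀)) ≤ a₀ * u ^ 2 - u * Real.sqrt β * K := by
    have hid : 4 * a₀ * (a₀ * u ^ 2 - u * Real.sqrt β * K) + β * K ^ 2 = (2 * a₀ * u - Real.sqrt β * K) ^ 2 := by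
      rw [show β * K ^ 2 = Real.sqrt β ^ 2 * K ^ 2 by rw [hsβ2]]; ring
    have hkey : 0 ≤ 4 * a₀ * (a₀ * u ^ 2 - u * Real.sqrt β * K) + β * K ^ 2 := by rw [hid]; positivity
    have hdiv : a₀ * u ^ 2 - u * Real.sqrt β * K + β * K ^ 2 / (4 * a₀) =
        (4 * a₀ * (a₀ * u ^ 2 - u * Real.sqrt β * K) + β * K ^ 2) / (4 * a₀) := by
      rw [eq_div_iff h4a.ne', add_mul, div_mul_cancel₀ _ h4a.ne']
      ring
    have hnn : 0 ≤ (4 * a₀ * (a₀ * u ^ 2 - u * Real.sqrt β * K) + β * K ^ 2) / (4 * a₀) := div_nonneg hkey h4a.le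
    linarith only [hdiv, hnn]
  have hbracket : K ^ 2 ≤ ((1 - a₀) ^ 2 + θ ^ 2) * ‖X‖ ^ 2 := by
    rw [← hpq, hK_def]
    nlinarith only [sq_nonneg ((1 - a₀) * ‖q‖ - θ * ‖p‖)]
  have hfin : β * K ^ 2 / (4 * a₀) ≤ β * ((1 - a₀) ^ 2 + θ ^ 2) / (4 * a₀) * ‖X‖ ^ 2 := by
    calc β * K ^ 2 / (4 * a₀) ≤ β * (((1 - a₀) ^ 2 + θ ^ 2) * ‖X‖ ^ 2) / (4 * a₀) :=
          div_le_div_of_nonneg_right (mul_le_mul_of_nonneg_left hbracket hβ0) h4a.le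
      _ = β * ((1 - a₀) ^ 2 + θ ^ 2) / (4 * a₀) * ‖X‖ ^ 2 := by ring
  calc ((1 - s) * a₀ - β * ((1 - a₀) ^ 2 + θ ^ 2) / (4 * a₀)) * ‖X‖ ^ 2
      = (1 - s) * a₀ * ‖X‖ ^ 2 - β * ((1 - a₀) ^ 2 + θ ^ 2) / (4 * a₀) * ‖X‖ ^ 2 := by ring
    _ ≤ (1 - s) * a₀ * ‖X‖ ^ 2 + (a₀ * u ^ 2 - u * Real.sqrt β * K) := by linarith only [hsquare, hfin]
    _ ≤ ⟪par Y M + a • perp Y M + σ ^ 2 • (Y * perp Y M), X⟫ := hmain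

end Pairing

end Summit.QuantumFields.YangMills.BalabanUVNodes.N08HaarCompatibilityGuardMonotonePairing

end
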